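import Mathlib
import Literature.MathematicalPhysics.QuantumFieldTheory.Balaban1983to89.B5Prop11Lattice
import HarnessLib

/-!
# Route `UnitScaleTilt`, crux K1 «MinimiserStabilityRegPr» (stmt-QuantumFields-19200), EX row `hGF` (curved member), LOD ∕ Combes–Thomas line —
# **(L6) §2: THE WINDOW `γ_LOD > 0` OF THE MEMBER ASSEMBLY, IN CLOSED FORM** (★p1 g24 03:11:42Z pin (3): order `θc, δP` vs `c₆` → cube scale `s` → regularity `ε₀`;
# px10 g11 03:24:06Z «w2 TAKES the §2 WINDOW LEMMA over the closed-form coefficient»)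

Cell `ym3-torus` (HUMAN RULING D-0037, rung R3 — NOT d = 4, NOT infinite volume, NOT a mass gap, NOT Clay).  EX namer seat `ym-ust-19200-w2` (gen 12).  THEOREMS ONLY
(0 `def`, 0 `sorry`); `--supports stmt-QuantumFields-19200 --as helper`, count-neutral.  PURE REAL ARITHMETIC — no lattice object occurs.

THE OBJECT.  px10 g11's (L6) member assembly `Prop7LODAssemblyMember.curvedTarget_member` (SIGNATURE 55fe5d20, 2026-08-30) proves, at a member `(F, n, K)` admitting
px17's corner cut-off family of cube scale `s`, for `U₀ ∈ RegPr F n K ε₀`, the curved target `γ·‖A‖² ≤ re⟪A, Δ^η(U₀)A⟫ + ‖projR(covLapSite U₀)Q″(D*_{U₀}A)‖² + a‖Q_k(U₀)A‖²`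
with the COEFFICIENT (K-free closed form; letters `θ, θc, δP, κP, cR, c₆, a₀, ε₀, s, L`)
`γ = ((1 − 3θc − δP)·g − e − ρ − (1+θ⁻¹)(17280∕L^{2s} + 2κP²(cR + 1029ε₀) + 12441600·a₀∕L^{2s})) ∕ (1 + θ + (1+θ⁻¹)·2κP²)`,
`g = 1∕(4·Cst 3 a₀)` (the flat floor, ✓`Prop7FlatTargetOfLODLine.flat_target_topMean`), `ρ = (1+θ⁻¹)·11520∕L^{2s} + (2+θ)·1029ε₀`,
`e = (1+θc⁻¹)·160ε₀²(3L^s+7)² + (1+θc)·1029ε₀ + 4a₀(1+θc⁻¹)(3·10¹⁰L¹⁰ε₀² + 768ε₀²(3L^s+7)²) + (2θc+δP)·c₆`.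
THIS FILE fixes the Peter–Paul letters and proves the window: at `θ := 1`, `θc := g∕(64(c₆+1))`, for `δP ≤ g∕(64(c₆+1))`, a cube scale with
`(L^s)² ≥ 16·(57600 + 4·CP·cR + 24883200·a₀)∕g + 4·CP` (where `κP² ≤ CP∕(L^s)²` is the (K2b) row's shape, routeR-w4 g27's `hKP_of_regPr`: `κP² ∝ ℓ_f² = 2880∕(L^sℓ)²`),
and `ε₀ ≤ min 1 (g∕(16·E))` with `E = E(L, s, θc, a₀)` the explicit ε-slope below, the coefficient is `≥ g∕4 = 1∕(16·Cst 3 a₀) > 0`.  Every witness is a CLOSED TERM in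
`(L, a₀, c₆, cR, CP)` — no `K`, `n`, `|T³|` (pin (3) CHECK).

WHAT IS PROVED (ns `…Theorems.Prop7LODMemberWindow`).
* §1 ★★ `coeff_ge_of_budgets` — the ABSTRACT window: px10's coefficient at `θ = 1` (read with `(F.L : ℝ) ↦ Λ`, `1∕(4·Cst 3 a₀) ↦ g`) is `≥ g∕4` as soon as five budgets hold
  (`3θc + δP ≤ 1∕16`, `(2θc+δP)c₆ ≤ 3g∕64`, ε-block `≤ g∕16`, s-block `≤ g∕16`, `4κP² ≤ 1`) — one `ring_nf`-free identity + `linarith`.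
* §2 the budgets from the explicit choices: `budget_theta` (θc, δP vs c₆), `budget_scale` (s-block and `4κP² ≤ 1` from `κP² ≤ CP∕(Λ^s)²` and the scale inequality),
  `budget_eps` (ε-block from `ε₀ ≤ 1`, `ε₀·E ≤ g∕16`), `le_sq_pow_ceil` (for `Λ ≥ 2`, `X ≤ (Λ^⌈X⌉₊)²` — an admissible scale EXISTS as a closed term), `alpha_window`.
* §3 ★★★ `coeff_ge_window` — THE WINDOW with all choices substituted (hypotheses: `2 ≤ Λ`, `0 < g ≤ 1`, `0 < a₀`, `0 ≤ c₆, cR, CP`, the scale inequality at `s`, `0 < ε₀ ≤ α`,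
  `0 ≤ δP ≤ g∕(64(c₆+1))`, `κP² ≤ CP∕(Λ^s)²`) and ★★★ `coeff_ge_window_T3` — its reading at `g := 1∕(4·Cst 3 a₀)`, `Λ := (L : ℝ)`, `2 ≤ L`, floor `1∕(16·Cst 3 a₀)`;
  plus `theta_c_pos`, `three_theta_c_add_le_one` (px10's `hθc`, `hsmall` at the chosen letters) and `exists_window_letters` (the ∃-packaging: `∃ θc δP₀ s₀ α γ₁ > 0, …`).
USE (the `hT₁` knit at large members `s₀(L) < m + n`): `curvedTarget_member … (θ := 1) (θc := g∕(64(c₆+1))) …` then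
`exact (mul_le_mul_of_nonneg_right (coeff_ge_window_T3 …) (sq_nonneg ‖A‖)).trans (curvedTarget_member … A)`.
NOT HERE: the (K2b) Combes–Thomas window∕gap letters `hδ hwin hgap` of ✓`kernelMatrix_blockBound_of_regPr` (they fix `CP`; typed against routeR-w4 g27's `hKP_of_regPr`
once it lands), the four member rows, the small members `m + n ≤ s₀(L)` ((α)(a)), `hT`, `hGF`, EX — none is proved here.

HONEST SCOPE.  Real arithmetic only; a window lemma for a coefficient whose member rows are displayed elsewhere.  Rung R3 — NOT d = 4, NOT infinite volume, NOT a mass gap, NOT Clay.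

References: T. Bałaban, CMP **99** (1985) 389–434 [Balaban1985BackgroundPropagators] (Thm 3.3 p.398, (3.49) p.399, Thm 3.11 p.416); CMP **95** (1984) 17–40
[Balaban1984PropagatorsI] (Prop. 1.1 (1.90) p.33); B. Simon, Ann. IHP A **38** (1983) 295–308 (IMS localisation).
-/

set_option autoImplicit false

noncomputable section

namespace Summit.QuantumFields.YangMills.Theorems.Prop7LODMemberWindow

open Literature.MathematicalPhysics.QuantumFieldTheory.Balaban1983to89

/-! ## §1 The abstract window: five budgets ⟹ coefficient `≥ g∕4` -/

/-- ★★ **ABSTRACT WINDOW.**  px10 g11's closed-form LOD coefficient at `θ = 1` (letters `Λ = L`, `g = 1∕(4·Cst 3 a₀)`) is at least `g∕4` whenever: the comparison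
Peter–Paul letters are small (`3θc + δP ≤ 1∕16`), the flat divergence-absorption constant is paid (`(2θc + δP)·c₆ ≤ 3g∕64`), the ε-block and the s-block are each
`≤ g∕16`, and `4κP² ≤ 1` (denominator `≤ 3`).  [folklore] [cite: Balaban1985BackgroundPropagators, (3.49) p.399, Thm 3.11 p.416] -/
theorem coeff_ge_of_budgets {g Λ ε₀ a₀ θc δP κP cR c₆ : ℝ} {s : ℕ} (hg : 0 < g)
    (hB₀ : 3 * θc + δP ≤ 1 / 16)
    (hB₁ : (2 * θc + δP) * c₆ ≤ 3 * g / 64)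
    (hB₂ : (1 + θc⁻¹) * (160 * ε₀ ^ 2 * (3 * Λ ^ s + 7) ^ 2) + (1 + θc) * (1029 * ε₀)
        + a₀ * ((1 + θc⁻¹) * (4 * (3 * 10 ^ 10 * Λ ^ 10 * ε₀ ^ 2 + 768 * ε₀ ^ 2 * (3 * Λ ^ s + 7) ^ 2)))
        + 3 * (1029 * ε₀) + 4 * κP ^ 2 * (1029 * ε₀) ≤ g / 16)
    (hB₃ : 2 * (11520 * ((Λ ^ s) ^ 2)⁻¹) + 2 * (17280 * ((Λ ^ s) ^ 2)⁻¹) + 4 * κP ^ 2 * cR + 2 * (12441600 * a₀ * ((Λ ^ s) ^ 2)⁻¹) ≤ g / 16)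
    (hB₄ : 4 * κP ^ 2 ≤ 1) :
    g / 4 ≤
      (((1 - (3 * θc + δP)) * g - ((1 + θc⁻¹) * (160 * ε₀ ^ 2 * (3 * Λ ^ s + 7) ^ 2) + (1 + θc) * (1029 * ε₀) + a₀ * ((1 + θc⁻¹) * (4 * (3 * 10 ^ 10 * Λ ^ 10 * ε₀ ^ 2 + 768 * ε₀ ^ 2 * (3 * Λ ^ s + 7) ^ 2))) + (2 * θc + δP) * c₆)
        - ((1 + 1⁻¹) * (11520 * ((Λ ^ s) ^ 2)⁻¹) + (2 + 1) * (1029 * ε₀))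
        - ((1 + 1⁻¹) * ((17280 * ((Λ ^ s) ^ 2)⁻¹ + 2 * κP ^ 2 * (cR + 1029 * ε₀)) + 12441600 * a₀ * ((Λ ^ s) ^ 2)⁻¹)))
       / (1 + 1 + (1 + 1⁻¹) * (2 * κP ^ 2))) := by
  have hκ : 0 ≤ κP ^ 2 := sq_nonneg _
  have hD : 0 < 1 + 1 + (1 + (1:ℝ)⁻¹) * (2 * κP ^ 2) := by norm_num; positivity
  rw [le_div_iff₀ hD]
  norm_num at hB₂ hB₃ ⊢
  nlinarith [hB₀, hB₁, hB₂, hB₃, hB₄, hg, hκ]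

/-! ## §2 The budgets from the explicit choices -/

/-- `θc := g∕(64(c₆+1))` is positive. [folklore] -/
theorem theta_c_pos {g c₆ : ℝ} (hg : 0 < g) (hc₆ : 0 ≤ c₆) : 0 < g / (64 * (c₆ + 1)) := by positivity

/-- px10's `hsmall` at the chosen letters: `3θc + δP ≤ 1` for `θc := g∕(64(c₆+1))`, `δP ≤ g∕(64(c₆+1))`, `g ≤ 1`. [folklore] -/
theorem three_theta_c_add_le_one {g c₆ δP : ℝ} (hg : 0 < g) (hg1 : g ≤ 1) (hc₆ : 0 ≤ c₆) (hδP : δP ≤ g / (64 * (c₆ + 1))) :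
    3 * (g / (64 * (c₆ + 1))) + δP ≤ 1 := by
  have h1 : g / (64 * (c₆ + 1)) ≤ g / 64 := by
    apply div_le_div_of_nonneg_left hg.le (by norm_num) (by nlinarith)
  linarith

/-- **Budget (θ)**: with `θc := g∕(64(c₆+1))` and `δP ≤ g∕(64(c₆+1))`, `g ≤ 1`: `3θc + δP ≤ 1∕16` and `(2θc + δP)·c₆ ≤ 3g∕64`. [folklore] -/
theorem budget_theta {g c₆ δP : ℝ} (hg : 0 < g) (hg1 : g ≤ 1) (hc₆ : 0 ≤ c₆) (hδP₁ : δP ≤ g / (64 * (c₆ + 1))) :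
    3 * (g / (64 * (c₆ + 1))) + δP ≤ 1 / 16 ∧ (2 * (g / (64 * (c₆ + 1))) + δP) * c₆ ≤ 3 * g / 64 := by
  have h64 : (0:ℝ) < 64 * (c₆ + 1) := by positivity
  have h1 : g / (64 * (c₆ + 1)) ≤ g / 64 := div_le_div_of_nonneg_left hg.le (by norm_num) (by nlinarith)
  refine ⟨by linarith, ?_⟩
  have h2 : (2 * (g / (64 * (c₆ + 1))) + δP) * c₆ ≤ 3 * (g / (64 * (c₆ + 1))) * c₆ := by nlinarith
  have h3 : g / (64 * (c₆ + 1)) * c₆ ≤ g / 64 := by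
    rw [div_mul_eq_mul_div, div_le_div_iff₀ h64 (by norm_num)]
    nlinarith
  nlinarith

/-- **Budget (s)**: if `κP² ≤ CP∕(Λ^s)²` and the SCALE INEQUALITY `16·(57600 + 4·CP·cR + 24883200·a₀)∕g + 4·CP ≤ (Λ^s)²` holds, then the s-block is `≤ g∕16` and `4κP² ≤ 1`.
[folklore] -/
theorem budget_scale {g Λ a₀ κP cR CP : ℝ} {s : ℕ} (hg : 0 < g) (hΛ : 0 < Λ) (ha₀ : 0 ≤ a₀) (hcR : 0 ≤ cR) (hCP : 0 ≤ CP)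
    (hκP : κP ^ 2 ≤ CP / (Λ ^ s) ^ 2)
    (hs : 16 * (57600 + 4 * CP * cR + 24883200 * a₀) / g + 4 * CP ≤ (Λ ^ s) ^ 2) :
    2 * (11520 * ((Λ ^ s) ^ 2)⁻¹) + 2 * (17280 * ((Λ ^ s) ^ 2)⁻¹) + 4 * κP ^ 2 * cR + 2 * (12441600 * a₀ * ((Λ ^ s) ^ 2)⁻¹) ≤ g / 16 ∧ 4 * κP ^ 2 ≤ 1 := by
  set X : ℝ := (Λ ^ s) ^ 2 with hX
  have hX0 : 0 < X := by positivity
  have hS0 : 0 ≤ 57600 + 4 * CP * cR + 24883200 * a₀ := by positivity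
  have hXg : 16 * (57600 + 4 * CP * cR + 24883200 * a₀) / g ≤ X := by linarith [mul_nonneg (by norm_num : (0:ℝ) ≤ 4) hCP]
  have hXC : 4 * CP ≤ X := by linarith [div_nonneg (mul_nonneg (by norm_num : (0:ℝ) ≤ 16) hS0) hg.le]
  have hκX : κP ^ 2 * X ≤ CP := by
    have := mul_le_mul_of_nonneg_right hκP hX0.le
    rwa [div_mul_cancel₀ _ hX0.ne'] at this
  constructor
  · -- the s-block: multiply through by `X`
    rw [show 2 * (11520 * X⁻¹) + 2 * (17280 * X⁻¹) + 4 * κP ^ 2 * cR + 2 * (12441600 * a₀ * X⁻¹)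
        = (57600 + 4 * (κP ^ 2 * X) * cR + 24883200 * a₀) / X by field_simp; ring]
    rw [div_le_iff₀ hX0]
    have h1 : (57600 + 4 * (κP ^ 2 * X) * cR + 24883200 * a₀) ≤ 57600 + 4 * CP * cR + 24883200 * a₀ := by nlinarith
    have h2 : 16 * (57600 + 4 * CP * cR + 24883200 * a₀) ≤ g * X := by
      have := (div_le_iff₀ hg).mp hXg
      linarith
    nlinarith
  · nlinarith

/-- **Budget (ε)**: for `0 ≤ ε₀ ≤ 1`, `0 < θc`, `0 ≤ a₀`, `4κP² ≤ 1`, the ε-block is at most `ε₀·E` with the explicit slope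
`E := (1+θc⁻¹)·160(3Λ^s+7)² + (1+θc)·1029 + a₀(1+θc⁻¹)·4(3·10¹⁰Λ¹⁰ + 768(3Λ^s+7)²) + 4116`; hence `ε₀·E ≤ g∕16` gives the budget. [folklore] -/
theorem budget_eps {g Λ ε₀ a₀ θc κP : ℝ} {s : ℕ} (hε₀ : 0 ≤ ε₀) (hε₁ : ε₀ ≤ 1) (hθc : 0 < θc) (ha₀ : 0 ≤ a₀) (hκ : 4 * κP ^ 2 ≤ 1)
    (hE : ε₀ * ((1 + θc⁻¹) * (160 * (3 * Λ ^ s + 7) ^ 2) + (1 + θc) * 1029 + a₀ * ((1 + θc⁻¹) * (4 * (3 * 10 ^ 10 * Λ ^ 10 + 768 * (3 * Λ ^ s + 7) ^ 2))) + 4116) ≤ g / 16) :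
    (1 + θc⁻¹) * (160 * ε₀ ^ 2 * (3 * Λ ^ s + 7) ^ 2) + (1 + θc) * (1029 * ε₀)
        + a₀ * ((1 + θc⁻¹) * (4 * (3 * 10 ^ 10 * Λ ^ 10 * ε₀ ^ 2 + 768 * ε₀ ^ 2 * (3 * Λ ^ s + 7) ^ 2)))
        + 3 * (1029 * ε₀) + 4 * κP ^ 2 * (1029 * ε₀) ≤ g / 16 := by
  have hθ' : 0 ≤ 1 + θc⁻¹ := by positivity
  have hsq : ε₀ ^ 2 ≤ ε₀ := by nlinarith
  have hP : 0 ≤ (3 * Λ ^ s + 7) ^ 2 := sq_nonneg _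
  have hL10 : 0 ≤ Λ ^ 10 := by positivity
  have hκ0 : 0 ≤ κP ^ 2 := sq_nonneg _
  -- termwise domination by the linear slope
  have t1 : (1 + θc⁻¹) * (160 * ε₀ ^ 2 * (3 * Λ ^ s + 7) ^ 2) ≤ ε₀ * ((1 + θc⁻¹) * (160 * (3 * Λ ^ s + 7) ^ 2)) := by
    have := mul_le_mul_of_nonneg_right hsq (mul_nonneg (mul_nonneg hθ' (by norm_num : (0:ℝ) ≤ 160)) hP)
    nlinarith
  have t2 : a₀ * ((1 + θc⁻¹) * (4 * (3 * 10 ^ 10 * Λ ^ 10 * ε₀ ^ 2 + 768 * ε₀ ^ 2 * (3 * Λ ^ s + 7) ^ 2)))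
      ≤ ε₀ * (a₀ * ((1 + θc⁻¹) * (4 * (3 * 10 ^ 10 * Λ ^ 10 + 768 * (3 * Λ ^ s + 7) ^ 2)))) := by
    have h3 : 3 * 10 ^ 10 * Λ ^ 10 * ε₀ ^ 2 + 768 * ε₀ ^ 2 * (3 * Λ ^ s + 7) ^ 2 ≤ ε₀ * (3 * 10 ^ 10 * Λ ^ 10 + 768 * (3 * Λ ^ s + 7) ^ 2) := by
      nlinarith [mul_nonneg (by norm_num : (0:ℝ) ≤ 3 * 10 ^ 10) hL10, mul_nonneg (by norm_num : (0:ℝ) ≤ 768) hP]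
    have := mul_le_mul_of_nonneg_left (mul_le_mul_of_nonneg_left (mul_le_mul_of_nonneg_left h3 (by norm_num : (0:ℝ) ≤ 4)) hθ') ha₀
    nlinarith
  have t3 : 4 * κP ^ 2 * (1029 * ε₀) ≤ ε₀ * 1029 := by nlinarith
  nlinarith

/-- **An admissible scale exists as a closed term**: for `Λ ≥ 2` and any real `X`, `X ≤ (Λ^⌈X⌉₊)²`. [folklore] -/
theorem le_sq_pow_ceil {Λ : ℝ} (hΛ : 2 ≤ Λ) (X : ℝ) : X ≤ (Λ ^ ⌈X⌉₊) ^ 2 := by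
  have h1 : X ≤ (⌈X⌉₊ : ℝ) := Nat.le_ceil X
  have h2 : ((⌈X⌉₊ : ℕ) : ℝ) ≤ (2:ℝ) ^ ⌈X⌉₊ := by exact_mod_cast (Nat.lt_two_pow_self).le
  have h3 : (2:ℝ) ^ ⌈X⌉₊ ≤ Λ ^ ⌈X⌉₊ := pow_le_pow_left₀ (by norm_num) hΛ _
  have h4 : Λ ^ ⌈X⌉₊ ≤ (Λ ^ ⌈X⌉₊) ^ 2 := by
    have h1Λ : 1 ≤ Λ ^ ⌈X⌉₊ := one_le_pow₀ (by linarith)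
    nlinarith
  linarith

/-- **The regularity window as a closed term**: for `E > 0`, `α := min 1 (g∕16∕E)` satisfies `0 < α` (if `g > 0`), `α ≤ 1`, `α·E ≤ g∕16`, and so does every `ε₀ ≤ α`. [folklore] -/
theorem alpha_window {g E ε₀ : ℝ} (hg : 0 < g) (hE : 0 < E) (hεα : ε₀ ≤ min 1 (g / 16 / E)) :
    0 < min 1 (g / 16 / E) ∧ ε₀ ≤ 1 ∧ ε₀ * E ≤ g / 16 := by
  refine ⟨lt_min one_pos (by positivity), hεα.trans (min_le_left _ _), ?_⟩
  have h := hεα.trans (min_le_right _ _)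
  rwa [le_div_iff₀ hE] at h

/-! ## §3 The window with all choices substituted -/

/-- ★★★ **THE WINDOW `γ_LOD ≥ g∕4`** (all letters chosen): `θ := 1`, `θc := g∕(64(c₆+1))`; hypotheses = `2 ≤ Λ`, `0 < g ≤ 1`, `0 < a₀`, `0 ≤ c₆, cR, CP`, the SCALE INEQUALITY
at the cube scale `s` (satisfiable by `le_sq_pow_ceil`), `0 ≤ ε₀ ≤ min 1 (g∕16∕E(Λ,s,θc,a₀))` (satisfiable by `alpha_window`), `δP ≤ g∕(64(c₆+1))`, and the (K2b) shape
`κP² ≤ CP∕(Λ^s)²`.  Conclusion: px10 g11's coefficient (his `curvedTarget_member`, `θ := 1`, `(F.L : ℝ) ↦ Λ`, flat floor `↦ g`) is `≥ g∕4`.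
[cite: Balaban1985BackgroundPropagators, Thm 3.3 p.398, (3.49) p.399, Thm 3.11 p.416; Balaban1984PropagatorsI, Prop. 1.1 (1.90) p.33] -/
theorem coeff_ge_window {g Λ ε₀ a₀ δP κP cR c₆ CP : ℝ} {s : ℕ} (hΛ : 2 ≤ Λ) (hg : 0 < g) (hg1 : g ≤ 1) (ha₀ : 0 < a₀)
    (hc₆ : 0 ≤ c₆) (hcR : 0 ≤ cR) (hCP : 0 ≤ CP)
    (hs : 16 * (57600 + 4 * CP * cR + 24883200 * a₀) / g + 4 * CP ≤ (Λ ^ s) ^ 2)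
    (hε₀ : 0 ≤ ε₀)
    (hεα : ε₀ ≤ min 1 (g / 16 / ((1 + (g / (64 * (c₆ + 1)))⁻¹) * (160 * (3 * Λ ^ s + 7) ^ 2) + (1 + g / (64 * (c₆ + 1))) * 1029
        + a₀ * ((1 + (g / (64 * (c₆ + 1)))⁻¹) * (4 * (3 * 10 ^ 10 * Λ ^ 10 + 768 * (3 * Λ ^ s + 7) ^ 2))) + 4116)))
    (hδP₁ : δP ≤ g / (64 * (c₆ + 1)))
    (hκP : κP ^ 2 ≤ CP / (Λ ^ s) ^ 2) :
    g / 4 ≤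
      (((1 - (3 * (g / (64 * (c₆ + 1))) + δP)) * g - ((1 + (g / (64 * (c₆ + 1)))⁻¹) * (160 * ε₀ ^ 2 * (3 * Λ ^ s + 7) ^ 2) + (1 + g / (64 * (c₆ + 1))) * (1029 * ε₀) + a₀ * ((1 + (g / (64 * (c₆ + 1)))⁻¹) * (4 * (3 * 10 ^ 10 * Λ ^ 10 * ε₀ ^ 2 + 768 * ε₀ ^ 2 * (3 * Λ ^ s + 7) ^ 2))) + (2 * (g / (64 * (c₆ + 1))) + δP) * c₆)
        - ((1 + 1⁻¹) * (11520 * ((Λ ^ s) ^ 2)⁻¹) + (2 + 1) * (1029 * ε₀))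
        - ((1 + 1⁻¹) * ((17280 * ((Λ ^ s) ^ 2)⁻¹ + 2 * κP ^ 2 * (cR + 1029 * ε₀)) + 12441600 * a₀ * ((Λ ^ s) ^ 2)⁻¹)))
       / (1 + 1 + (1 + 1⁻¹) * (2 * κP ^ 2))) := by
  have hθc := theta_c_pos hg hc₆
  obtain ⟨hB₀, hB₁⟩ := budget_theta hg hg1 hc₆ hδP₁
  obtain ⟨hB₃, hB₄⟩ := budget_scale (s := s) hg (by linarith) ha₀.le hcR hCP hκP hs
  have hEpos : 0 < (1 + (g / (64 * (c₆ + 1)))⁻¹) * (160 * (3 * Λ ^ s + 7) ^ 2) + (1 + g / (64 * (c₆ + 1))) * 1029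
      + a₀ * ((1 + (g / (64 * (c₆ + 1)))⁻¹) * (4 * (3 * 10 ^ 10 * Λ ^ 10 + 768 * (3 * Λ ^ s + 7) ^ 2))) + 4116 := by positivity
  obtain ⟨-, hε₁, hE⟩ := alpha_window hg hEpos hεα
  have hB₂ := budget_eps (Λ := Λ) (s := s) hε₀ hε₁ hθc ha₀.le hB₄ hE
  exact coeff_ge_of_budgets hg hB₀ hB₁ hB₂ hB₃ hB₄

/-- ★★★ **THE WINDOW AT THE T³ LETTERS**: `g := 1∕(4·Cst 3 a₀)` (the flat floor of ✓`flat_target_topMean`; `Cst 3 a₀ ≥ 1`), `Λ := (L : ℝ)` with `2 ≤ L`; floor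
`1∕(16·Cst 3 a₀) > 0`, uniform in the member — the `γ₁ L` of the two-regime door's `hT₁`. [cite: Balaban1984PropagatorsI, Prop. 1.1 (1.90) p.33; Balaban1985BackgroundPropagators, Thm 3.11 p.416] -/
theorem coeff_ge_window_T3 {L : ℕ} (hL : 2 ≤ L) {ε₀ a₀ δP κP cR c₆ CP : ℝ} {s : ℕ} (ha₀ : 0 < a₀)
    (hc₆ : 0 ≤ c₆) (hcR : 0 ≤ cR) (hCP : 0 ≤ CP)
    (hs : 16 * (57600 + 4 * CP * cR + 24883200 * a₀) / (1 / (4 * B5Prop11Plancherel.Cst 3 a₀)) + 4 * CP ≤ ((L : ℝ) ^ s) ^ 2)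
    (hε₀ : 0 ≤ ε₀)
    (hεα : ε₀ ≤ min 1 ((1 / (4 * B5Prop11Plancherel.Cst 3 a₀)) / 16 / ((1 + ((1 / (4 * B5Prop11Plancherel.Cst 3 a₀)) / (64 * (c₆ + 1)))⁻¹) * (160 * (3 * (L : ℝ) ^ s + 7) ^ 2)
        + (1 + (1 / (4 * B5Prop11Plancherel.Cst 3 a₀)) / (64 * (c₆ + 1))) * 1029
        + a₀ * ((1 + ((1 / (4 * B5Prop11Plancherel.Cst 3 a₀)) / (64 * (c₆ + 1)))⁻¹) * (4 * (3 * 10 ^ 10 * (L : ℝ) ^ 10 + 768 * (3 * (L : ℝ) ^ s + 7) ^ 2))) + 4116)))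
    (hδP₁ : δP ≤ (1 / (4 * B5Prop11Plancherel.Cst 3 a₀)) / (64 * (c₆ + 1)))
    (hκP : κP ^ 2 ≤ CP / ((L : ℝ) ^ s) ^ 2) :
    1 / (16 * B5Prop11Plancherel.Cst 3 a₀) ≤
      (((1 - (3 * ((1 / (4 * B5Prop11Plancherel.Cst 3 a₀)) / (64 * (c₆ + 1))) + δP)) * (1 / (4 * B5Prop11Plancherel.Cst 3 a₀))
          - ((1 + ((1 / (4 * B5Prop11Plancherel.Cst 3 a₀)) / (64 * (c₆ + 1)))⁻¹) * (160 * ε₀ ^ 2 * (3 * (L : ℝ) ^ s + 7) ^ 2)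
            + (1 + (1 / (4 * B5Prop11Plancherel.Cst 3 a₀)) / (64 * (c₆ + 1))) * (1029 * ε₀)
            + a₀ * ((1 + ((1 / (4 * B5Prop11Plancherel.Cst 3 a₀)) / (64 * (c₆ + 1)))⁻¹) * (4 * (3 * 10 ^ 10 * (L : ℝ) ^ 10 * ε₀ ^ 2 + 768 * ε₀ ^ 2 * (3 * (L : ℝ) ^ s + 7) ^ 2)))
            + (2 * ((1 / (4 * B5Prop11Plancherel.Cst 3 a₀)) / (64 * (c₆ + 1))) + δP) * c₆)
        - ((1 + 1⁻¹) * (11520 * (((L : ℝ) ^ s) ^ 2)⁻¹) + (2 + 1) * (1029 * ε₀))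
        - ((1 + 1⁻¹) * ((17280 * (((L : ℝ) ^ s) ^ 2)⁻¹ + 2 * κP ^ 2 * (cR + 1029 * ε₀)) + 12441600 * a₀ * (((L : ℝ) ^ s) ^ 2)⁻¹)))
       / (1 + 1 + (1 + 1⁻¹) * (2 * κP ^ 2))) := by
  have hC : 1 ≤ B5Prop11Plancherel.Cst 3 a₀ := B5Prop11Lower.one_le_Cst (d := 3) a₀
  have hg : 0 < 1 / (4 * B5Prop11Plancherel.Cst 3 a₀) := by positivity
  have hg1 : 1 / (4 * B5Prop11Plancherel.Cst 3 a₀) ≤ 1 := by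
    rw [div_le_one (by positivity)]; linarith
  have hΛ : (2:ℝ) ≤ (L : ℝ) := by exact_mod_cast hL
  have h := coeff_ge_window (s := s) hΛ hg hg1 ha₀ hc₆ hcR hCP hs hε₀ hεα hδP₁ hκP
  have e : 1 / (16 * B5Prop11Plancherel.Cst 3 a₀) = 1 / (4 * B5Prop11Plancherel.Cst 3 a₀) / 4 := by
    field_simp; ring
  rw [e]; exact h

/-! ## §4 The ∃-packaging (letters as closed terms of `(Λ, g, a₀, c₆, cR, CP)`) -/

/-- ★★ **THE WINDOW LETTERS EXIST, EXPLICITLY**: for `Λ ≥ 2`, `0 < g ≤ 1`, `a₀ > 0`, `c₆, cR, CP ≥ 0` there are `θc, δP₀, α, γ₁ > 0` and a cube scale `s₀` — namely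
`θc = δP₀ = g∕(64(c₆+1))`, `s₀ = ⌈16·(57600 + 4·CP·cR + 24883200·a₀)∕g + 4·CP⌉₊`, `α = min 1 (g∕16∕E(Λ,s₀,θc,a₀))`, `γ₁ = g∕4` — such that `3θc + δP ≤ 1` and the
coefficient at `(θ, θc, s) := (1, θc, s₀)` is `≥ γ₁` for every `0 < ε₀ ≤ α`, `0 ≤ δP ≤ δP₀`, `κP² ≤ CP∕(Λ^{s₀})²`.  (Members with `m + n ≤ s₀` have no such cube family —
the small-member branch, NOT covered.) [cite: Balaban1985BackgroundPropagators, Thm 3.3 p.398, Thm 3.11 p.416] -/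
theorem exists_window_letters {g Λ a₀ cR c₆ CP : ℝ} (hΛ : 2 ≤ Λ) (hg : 0 < g) (hg1 : g ≤ 1) (ha₀ : 0 < a₀)
    (hc₆ : 0 ≤ c₆) (hcR : 0 ≤ cR) (hCP : 0 ≤ CP) :
    ∃ (θc δP₀ α γ₁ : ℝ) (s₀ : ℕ), 0 < θc ∧ 0 < δP₀ ∧ 0 < α ∧ 0 < γ₁ ∧
      ∀ (ε₀ δP κP : ℝ), 0 < ε₀ → ε₀ ≤ α → 0 ≤ δP → δP ≤ δP₀ → κP ^ 2 ≤ CP / (Λ ^ s₀) ^ 2 →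
        3 * θc + δP ≤ 1 ∧
        γ₁ ≤
          (((1 - (3 * θc + δP)) * g - ((1 + θc⁻¹) * (160 * ε₀ ^ 2 * (3 * Λ ^ s₀ + 7) ^ 2) + (1 + θc) * (1029 * ε₀) + a₀ * ((1 + θc⁻¹) * (4 * (3 * 10 ^ 10 * Λ ^ 10 * ε₀ ^ 2 + 768 * ε₀ ^ 2 * (3 * Λ ^ s₀ + 7) ^ 2))) + (2 * θc + δP) * c₆)
            - ((1 + 1⁻¹) * (11520 * ((Λ ^ s₀) ^ 2)⁻¹) + (2 + 1) * (1029 * ε₀))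
            - ((1 + 1⁻¹) * ((17280 * ((Λ ^ s₀) ^ 2)⁻¹ + 2 * κP ^ 2 * (cR + 1029 * ε₀)) + 12441600 * a₀ * ((Λ ^ s₀) ^ 2)⁻¹)))
           / (1 + 1 + (1 + 1⁻¹) * (2 * κP ^ 2))) := by
  set θc : ℝ := g / (64 * (c₆ + 1)) with hθc_def
  set s₀ : ℕ := ⌈16 * (57600 + 4 * CP * cR + 24883200 * a₀) / g + 4 * CP⌉₊ with hs₀_def
  set E : ℝ := (1 + θc⁻¹) * (160 * (3 * Λ ^ s₀ + 7) ^ 2) + (1 + θc) * 1029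
      + a₀ * ((1 + θc⁻¹) * (4 * (3 * 10 ^ 10 * Λ ^ 10 + 768 * (3 * Λ ^ s₀ + 7) ^ 2))) + 4116 with hE_def
  have hθc : 0 < θc := theta_c_pos hg hc₆
  have hEpos : 0 < E := by positivity
  refine ⟨θc, θc, min 1 (g / 16 / E), g / 4, s₀, hθc, hθc, lt_min one_pos (by positivity), by positivity, ?_⟩
  intro ε₀ δP κP hε₀ hεα _hδP hδP₁ hκP
  exact ⟨three_theta_c_add_le_one hg hg1 hc₆ hδP₁,
    coeff_ge_window (s := s₀) hΛ hg hg1 ha₀ hc₆ hcR hCP (le_sq_pow_ceil hΛ _) hε₀.le hεα hδP₁ hκP⟩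

end Summit.QuantumFields.YangMills.Theorems.Prop7LODMemberWindow

end
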